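import Summits.QuantumFields.BalabanUV.T4Continuum.Support.DirichletCornerCutoffH2

/-!
# T⁴ programme, spine node NE2 (U1a), sub-row Δ1 «NE2⁰-Dirichlet» — THE CUTOFF `H²` INEQUALITY WITH LOCAL REMAINDERS: position-dependent
# difference bounds `g(x)`, `h(x)` of the cutoff, so that the commutator cost is carried by the transition layer only

NE2 formalisation swarm `b2b-balaban-t4-ne2-formalise-*`, LEAF PROVER 09 (gen 10), supplier item «Δ1-SCALAR-CORNER-H2» file 2b (journal
`HOME/CLAIMS.log` 2026-08-21 l.23790 / l.24724; memo `t4/T4-EST-NE2-D1-CORNER.md` §4 (W-H)).  File 2 `Support/DirichletCornerCutoffH2`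
(p244052) bounds `Σ_μ Σ_{x∈Ω} φ(x)²|(P_μz)(x)|²` with GLOBAL difference bounds `|δφ| ≤ g`, `|Δ_μφ| ≤ h` and hence GLOBAL remainders
`g²·E_c(z)`, `h²·‖z‖²_Ω`.  The dyadic step of route r5 sums the cutoff family `φ_R` with weights `R^p` and needs the remainder of `φ_R` to live
on ITS transition layer only.  THIS FILE re-runs file 2's argument with POSITION-DEPENDENT bounds
`hg : ∀ y ν, |φ(y+e_ν) − φ(y)| ≤ g y ∧ |φ(y−e_ν) − φ(y)| ≤ g y`, `hh : ∀ y ν, |φ(y+e_ν) + φ(y−e_ν) − 2φ(y)| ≤ h y` (`g, h ≥ 0`):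

 * §1 pointwise: **`norm_comm_Pdir_le_local`**, `norm_phi_mul_Pdir_le_local`, `sq_phi_mul_normSq_Pdir_le_local`, `norm_LapS_phi_mul_le_local`;
 * §2 **`sum_normSq_LapS_phi_mul_le_local`** and **THE END `weighted_hdiag_le_local`** (`z` supported in `Ω`, `φ` kills the corner layer):
   `Σ_μ Σ_{x∈Ω} φ(x)²|(P_μz)(x)|² ≤ 8Σ_{x∈Ω}φ(x)²|(Δz)(x)|² + (48d + 8)‖c‖²·Σ_μ Σ_x (g(x)² + g(x+e_μ)²)|(∂_μz)(x)|²
   + (24d² + 4d)(‖c‖²)²·Σ_{x∈Ω} h(x)²|z(x)|²` — the remainders see only `supp g ∪ (supp g − e_μ)` and `supp h`, i.e. the transition layer of the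
   cutoff (a cutoff `φ_R` that is `0` within `R/2` of the edges and `1` beyond `R` pays `≲ R⁻²·E(T_R ∖ T_{R/2}) + R⁻⁴·‖z‖²(T_R ∖ T_{R/2})`).

HONEST FRAMING (T4-DAG p. 1).  [folklore] finite lattice calculus on the cell's typed `U = 1` objects (one region, finite torus); the
cutoff and its local bounds are DATA; nothing about [B9]'s printed regions; `hinjK` ∕ W3 off boxes OPEN; Δ1 NOT closed; NE2 (U1a) NOT
proved; spine PROVED 0/9 unchanged; NOT [B9] (3.16)/(3.23)–(3.27)/(3.42) as printed; NOT infinite volume, NOT a mass gap, NOT the Clay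
problem.  HONEST DEPENDENCY: continuum YM on T⁴ ⇐ BetaPertH ∧ nine spine estimates (0/9 proved); BetaPertH ⇐ (D1) ∧ (D4) ∧ CAP+tail;
G-an2-4 gates asym, D1 and NE2/3/4.  No `sorry`.
-/

noncomputable section
open scoped BigOperators ComplexConjugate Matrix
open Finset
namespace Summit.QuantumFields.BalabanUV.T4Continuum.DirichletCornerCutoffH2Local

open Literature.MathematicalPhysics.QuantumFieldTheory.Balaban1983to89.B5Prop11Plancherel (Tor fine unitVec)
open Literature.MathematicalPhysics.QuantumFieldTheory.Balaban1983to89.B5Action121 (sdiff LapS sdiff_mulVec)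
open Literature.MathematicalPhysics.QuantumFieldTheory.Balaban1983to89.B5Prop11Lower (nsq nsq_nonneg)
open Summit.QuantumFields.BalabanUV.T4Continuum
open Summit.QuantumFields.BalabanUV.T4Continuum.ScalarAveragedPropagator (gammaPs gammaPs_pos)
open Summit.QuantumFields.BalabanUV.Beta.GAN24.DirichletBoxRegularity (Pdir Pdir_mulVec LapS_mulVec_eq_sum SuppIn Hdiag Hmixed hmixed_nonneg)
open Summit.QuantumFields.BalabanUV.Beta.GAN24.DirichletBoxCompression (solExt solExt_apply_of_not dirichlet_solExt_le nsq_solExt_le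
  sum_normSq_LapS_solExt_le)
open Summit.QuantumFields.BalabanUV.Beta.GAN24.DirichletBoxTrace (blockReg)
open Summit.QuantumFields.BalabanUV.T4Continuum.DirichletCornerRegularity (cornerSites hdiag_le_of_cornerVanish)
open Summit.QuantumFields.BalabanUV.T4Continuum.DirichletCornerCutoffH2 (phi_mul_Pdir_eq mul_sub_eq_neg_sdiff mul_sub_eq_sdiff
  sum_normSq_sdiff_shift sum_le_univ_of_nonneg)

variable {d : ℕ} {N : Fin d → ℕ} [hN : ∀ μ, NeZero (N μ)]

/-! ## §1 Pointwise bounds with position-dependent difference bounds -/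

/-- **THE POINTWISE COMMUTATOR BOUND, LOCAL FORM**: if `|φ(y±e_ν) − φ(y)| ≤ g(y)` and `|φ(y+e_ν) + φ(y−e_ν) − 2φ(y)| ≤ h(y)` then
`|φ(x)(P_μz)(x) − (P_μ(φz))(x)| ≤ ‖c‖g(x)·(|(∂_μz)(x)| + |(∂_μz)(x−e_μ)|) + ‖c‖²h(x)·|z(x)|`. [folklore] -/
theorem norm_comm_Pdir_le_local (c : ℂ) (μ : Fin d) {φ g h : Tor N → ℝ}
    (hg : ∀ y ν, |φ (y + unitVec N ν) - φ y| ≤ g y ∧ |φ (y - unitVec N ν) - φ y| ≤ g y)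
    (hh : ∀ y ν, |φ (y + unitVec N ν) + φ (y - unitVec N ν) - 2 * φ y| ≤ h y) (z : Tor N → ℂ) (x : Tor N) :
    ‖(φ x : ℂ) * (Pdir N c μ *ᵥ z) x - (Pdir N c μ *ᵥ fun y => (φ y : ℂ) * z y) x‖
      ≤ ‖c‖ * g x * (‖(sdiff N c μ *ᵥ z) x‖ + ‖(sdiff N c μ *ᵥ z) (x - unitVec N μ)‖) + ‖c‖ ^ 2 * h x * ‖z x‖ := by
  have hgp := (hg x μ).1
  have hgm := (hg x μ).2
  have hcomm : (φ x : ℂ) * (Pdir N c μ *ᵥ z) x - (Pdir N c μ *ᵥ fun y => (φ y : ℂ) * z y) x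
      = conj c * c * (((φ (x + unitVec N μ) - φ x : ℝ) : ℂ) * (z (x + unitVec N μ) - z x)
            + ((φ (x - unitVec N μ) - φ x : ℝ) : ℂ) * (z (x - unitVec N μ) - z x))
        + conj c * c * ((φ (x + unitVec N μ) + φ (x - unitVec N μ) - 2 * φ x : ℝ) : ℂ) * z x := by
    rw [phi_mul_Pdir_eq c μ φ z x]; ring
  rw [hcomm]
  refine (norm_add_le _ _).trans (add_le_add ?_ ?_)
  · rw [norm_mul, norm_mul, Complex.norm_conj]
    have e1 : ‖c‖ * ‖z (x + unitVec N μ) - z x‖ = ‖(sdiff N c μ *ᵥ z) x‖ := by rw [← norm_mul, mul_sub_eq_sdiff]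
    have e2 : ‖c‖ * ‖z (x - unitVec N μ) - z x‖ = ‖(sdiff N c μ *ᵥ z) (x - unitVec N μ)‖ := by
      rw [← norm_mul, mul_sub_eq_neg_sdiff, norm_neg]
    have hcc : 0 ≤ ‖c‖ * ‖c‖ := by positivity
    calc ‖c‖ * ‖c‖ * ‖((φ (x + unitVec N μ) - φ x : ℝ) : ℂ) * (z (x + unitVec N μ) - z x)
            + ((φ (x - unitVec N μ) - φ x : ℝ) : ℂ) * (z (x - unitVec N μ) - z x)‖
        ≤ ‖c‖ * ‖c‖ * (‖((φ (x + unitVec N μ) - φ x : ℝ) : ℂ) * (z (x + unitVec N μ) - z x)‖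
            + ‖((φ (x - unitVec N μ) - φ x : ℝ) : ℂ) * (z (x - unitVec N μ) - z x)‖) :=
          mul_le_mul_of_nonneg_left (norm_add_le _ _) hcc
      _ = ‖c‖ * ‖c‖ * (|φ (x + unitVec N μ) - φ x| * ‖z (x + unitVec N μ) - z x‖
            + |φ (x - unitVec N μ) - φ x| * ‖z (x - unitVec N μ) - z x‖) := by
          rw [norm_mul, norm_mul, Complex.norm_real, Complex.norm_real, Real.norm_eq_abs, Real.norm_eq_abs]
      _ ≤ ‖c‖ * ‖c‖ * (g x * ‖z (x + unitVec N μ) - z x‖ + g x * ‖z (x - unitVec N μ) - z x‖) := by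
          gcongr
      _ = ‖c‖ * g x * (‖c‖ * ‖z (x + unitVec N μ) - z x‖ + ‖c‖ * ‖z (x - unitVec N μ) - z x‖) := by ring
      _ = ‖c‖ * g x * (‖(sdiff N c μ *ᵥ z) x‖ + ‖(sdiff N c μ *ᵥ z) (x - unitVec N μ)‖) := by rw [e1, e2]
  · rw [norm_mul, norm_mul, norm_mul, Complex.norm_conj, Complex.norm_real, Real.norm_eq_abs]
    have hhp := hh x μ
    calc ‖c‖ * ‖c‖ * |φ (x + unitVec N μ) + φ (x - unitVec N μ) - 2 * φ x| * ‖z x‖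
        ≤ ‖c‖ * ‖c‖ * h x * ‖z x‖ := by gcongr
      _ = ‖c‖ ^ 2 * h x * ‖z x‖ := by ring

/-- the squared local form:
`φ(x)²|(P_μz)(x)|² ≤ 4·(|(P_μ(φz))(x)|² + ‖c‖²g(x)²|(∂_μz)(x)|² + ‖c‖²g(x)²|(∂_μz)(x−e_μ)|² + ‖c‖⁴h(x)²|z(x)|²)`. [folklore] -/
theorem sq_phi_mul_normSq_Pdir_le_local (c : ℂ) (μ : Fin d) {φ g h : Tor N → ℝ}
    (hg : ∀ y ν, |φ (y + unitVec N ν) - φ y| ≤ g y ∧ |φ (y - unitVec N ν) - φ y| ≤ g y)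
    (hh : ∀ y ν, |φ (y + unitVec N ν) + φ (y - unitVec N ν) - 2 * φ y| ≤ h y) (z : Tor N → ℂ) (x : Tor N) :
    φ x ^ 2 * ‖(Pdir N c μ *ᵥ z) x‖ ^ 2
      ≤ 4 * (‖(Pdir N c μ *ᵥ fun y => (φ y : ℂ) * z y) x‖ ^ 2 + ‖c‖ ^ 2 * g x ^ 2 * ‖(sdiff N c μ *ᵥ z) x‖ ^ 2
          + ‖c‖ ^ 2 * g x ^ 2 * ‖(sdiff N c μ *ᵥ z) (x - unitVec N μ)‖ ^ 2 + (‖c‖ ^ 2) ^ 2 * h x ^ 2 * ‖z x‖ ^ 2) := by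
  have h1 := norm_comm_Pdir_le_local c μ hg hh z x
  have h2 : ‖(φ x : ℂ) * (Pdir N c μ *ᵥ z) x‖
      ≤ ‖(Pdir N c μ *ᵥ fun y => (φ y : ℂ) * z y) x‖
        + ‖(φ x : ℂ) * (Pdir N c μ *ᵥ z) x - (Pdir N c μ *ᵥ fun y => (φ y : ℂ) * z y) x‖ := by
    have := norm_add_le ((Pdir N c μ *ᵥ fun y => (φ y : ℂ) * z y) x)
      ((φ x : ℂ) * (Pdir N c μ *ᵥ z) x - (Pdir N c μ *ᵥ fun y => (φ y : ℂ) * z y) x)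
    rwa [add_sub_cancel] at this
  have hsq : φ x ^ 2 * ‖(Pdir N c μ *ᵥ z) x‖ ^ 2 = ‖(φ x : ℂ) * (Pdir N c μ *ᵥ z) x‖ ^ 2 := by
    rw [norm_mul, Complex.norm_real, Real.norm_eq_abs, mul_pow, sq_abs]
  rw [hsq]
  have h0 : 0 ≤ ‖(φ x : ℂ) * (Pdir N c μ *ᵥ z) x‖ := norm_nonneg _
  set p := ‖(Pdir N c μ *ᵥ fun y => (φ y : ℂ) * z y) x‖
  set q := ‖c‖ * g x * ‖(sdiff N c μ *ᵥ z) x‖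
  set r := ‖c‖ * g x * ‖(sdiff N c μ *ᵥ z) (x - unitVec N μ)‖
  set t := ‖c‖ ^ 2 * h x * ‖z x‖
  have h3 : ‖(φ x : ℂ) * (Pdir N c μ *ᵥ z) x‖ ≤ p + q + r + t := (h2.trans (add_le_add le_rfl h1)).trans (le_of_eq (by ring))
  have h4 : (p + q + r + t) ^ 2 ≤ 4 * (p ^ 2 + q ^ 2 + r ^ 2 + t ^ 2) := by
    nlinarith [sq_nonneg (p - q), sq_nonneg (p - r), sq_nonneg (p - t), sq_nonneg (q - r), sq_nonneg (q - t), sq_nonneg (r - t)]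
  calc ‖(φ x : ℂ) * (Pdir N c μ *ᵥ z) x‖ ^ 2 ≤ (p + q + r + t) ^ 2 := pow_le_pow_left₀ h0 h3 2
    _ ≤ 4 * (p ^ 2 + q ^ 2 + r ^ 2 + t ^ 2) := h4
    _ = _ := by simp only [p, q, r, t]; ring

/-- the `Δ` Leibniz rule in local norm form:
`|(Δ(φz))(x)| ≤ |φ(x)|·|(Δz)(x)| + Σ_μ (‖c‖g(x)·(|(∂_μz)(x)| + |(∂_μz)(x−e_μ)|) + ‖c‖²h(x)·|z(x)|)`. [folklore] -/
theorem norm_LapS_phi_mul_le_local (c : ℂ) {φ g h : Tor N → ℝ}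
    (hg : ∀ y ν, |φ (y + unitVec N ν) - φ y| ≤ g y ∧ |φ (y - unitVec N ν) - φ y| ≤ g y)
    (hh : ∀ y ν, |φ (y + unitVec N ν) + φ (y - unitVec N ν) - 2 * φ y| ≤ h y) (z : Tor N → ℂ) (x : Tor N) :
    ‖(LapS N c *ᵥ fun y => (φ y : ℂ) * z y) x‖
      ≤ |φ x| * ‖(LapS N c *ᵥ z) x‖
        + ∑ μ, (‖c‖ * g x * (‖(sdiff N c μ *ᵥ z) x‖ + ‖(sdiff N c μ *ᵥ z) (x - unitVec N μ)‖) + ‖c‖ ^ 2 * h x * ‖z x‖) := by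
  set w : Tor N → ℂ := fun y => (φ y : ℂ) * z y with hw
  have hsplit : (LapS N c *ᵥ w) x
      = (φ x : ℂ) * (LapS N c *ᵥ z) x - ∑ μ, ((φ x : ℂ) * (Pdir N c μ *ᵥ z) x - (Pdir N c μ *ᵥ w) x) := by
    rw [LapS_mulVec_eq_sum, LapS_mulVec_eq_sum, mul_sum, ← sum_sub_distrib]
    exact sum_congr rfl fun μ _ => by ring
  rw [hsplit]
  refine (norm_sub_le _ _).trans (add_le_add ?_ ?_)
  · rw [norm_mul, Complex.norm_real, Real.norm_eq_abs]
  · exact (norm_sum_le _ _).trans (sum_le_sum fun μ _ => norm_comm_Pdir_le_local c μ hg hh z x)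

/-! ## §2 Summed over the region with local remainders -/

section Sums

variable (c : ℂ) (Ω : Finset (Tor N)) {φ g h : Tor N → ℝ} (z : Tor N → ℂ)

omit hN in
/-- reindexing the backward energy: `Σ_x g(x)²·|(∂_μz)(x − e_μ)|² = Σ_x g(x + e_μ)²·|(∂_μz)(x)|²`. [folklore] -/
theorem sum_sq_mul_normSq_sdiff_shift [∀ μ, NeZero (N μ)] (g : Tor N → ℝ) (μ : Fin d) :
    ∑ x, g x ^ 2 * ‖(sdiff N c μ *ᵥ z) (x - unitVec N μ)‖ ^ 2 = ∑ x, g (x + unitVec N μ) ^ 2 * ‖(sdiff N c μ *ᵥ z) x‖ ^ 2 :=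
  Fintype.sum_equiv (Equiv.subRight (unitVec N μ)) _ _ fun x => by
    simp only [Equiv.subRight_apply, sub_add_cancel]

/-- the local energy remainder of one direction: `Σ_{x∈Ω} g²(|∂_μz(x)|² + |∂_μz(x−e_μ)|²) ≤ Σ_x (g(x)² + g(x+e_μ)²)|∂_μz(x)|²`. [folklore] -/
theorem sum_local_energy_le (μ : Fin d) :
    ∑ x ∈ Ω, (g x ^ 2 * ‖(sdiff N c μ *ᵥ z) x‖ ^ 2 + g x ^ 2 * ‖(sdiff N c μ *ᵥ z) (x - unitVec N μ)‖ ^ 2)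
      ≤ ∑ x, (g x ^ 2 + g (x + unitVec N μ) ^ 2) * ‖(sdiff N c μ *ᵥ z) x‖ ^ 2 := by
  refine (sum_le_univ_of_nonneg Ω (fun x => by positivity)).trans (le_of_eq ?_)
  rw [sum_add_distrib, sum_sq_mul_normSq_sdiff_shift c z g μ, ← sum_add_distrib]
  exact sum_congr rfl fun x _ => by ring

/-- **THE `Δ` SIDE, LOCAL FORM**:
`Σ_{x∈Ω}|(Δ(φz))(x)|² ≤ 2Σ_{x∈Ω}φ²|Δz|² + 6d‖c‖²·Σ_μΣ_x (g(x)² + g(x+e_μ)²)|∂_μz(x)|² + 6d²(‖c‖²)²·Σ_{x∈Ω} h(x)²|z(x)|²`. [folklore] -/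
theorem sum_normSq_LapS_phi_mul_le_local
    (hg : ∀ y ν, |φ (y + unitVec N ν) - φ y| ≤ g y ∧ |φ (y - unitVec N ν) - φ y| ≤ g y)
    (hh : ∀ y ν, |φ (y + unitVec N ν) + φ (y - unitVec N ν) - 2 * φ y| ≤ h y) :
    ∑ x ∈ Ω, ‖(LapS N c *ᵥ fun y => (φ y : ℂ) * z y) x‖ ^ 2
      ≤ 2 * ∑ x ∈ Ω, φ x ^ 2 * ‖(LapS N c *ᵥ z) x‖ ^ 2
        + 6 * d * ‖c‖ ^ 2 * ∑ μ, ∑ x, (g x ^ 2 + g (x + unitVec N μ) ^ 2) * ‖(sdiff N c μ *ᵥ z) x‖ ^ 2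
        + 6 * (d : ℝ) ^ 2 * (‖c‖ ^ 2) ^ 2 * ∑ x ∈ Ω, h x ^ 2 * ‖z x‖ ^ 2 := by
  have hpt : ∀ x, ‖(LapS N c *ᵥ fun y => (φ y : ℂ) * z y) x‖ ^ 2
      ≤ 2 * (φ x ^ 2 * ‖(LapS N c *ᵥ z) x‖ ^ 2)
        + 2 * d * ∑ μ, 3 * (‖c‖ ^ 2 * g x ^ 2 * ‖(sdiff N c μ *ᵥ z) x‖ ^ 2
            + ‖c‖ ^ 2 * g x ^ 2 * ‖(sdiff N c μ *ᵥ z) (x - unitVec N μ)‖ ^ 2 + (‖c‖ ^ 2) ^ 2 * h x ^ 2 * ‖z x‖ ^ 2) := by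
    intro x
    set A := |φ x| * ‖(LapS N c *ᵥ z) x‖ with hA
    set T : Fin d → ℝ := fun μ =>
      ‖c‖ * g x * (‖(sdiff N c μ *ᵥ z) x‖ + ‖(sdiff N c μ *ᵥ z) (x - unitVec N μ)‖) + ‖c‖ ^ 2 * h x * ‖z x‖ with hT
    have h1 : ‖(LapS N c *ᵥ fun y => (φ y : ℂ) * z y) x‖ ≤ A + ∑ μ, T μ := norm_LapS_phi_mul_le_local c hg hh z x
    have hA0 : 0 ≤ A := mul_nonneg (abs_nonneg _) (norm_nonneg _)
    have hg0 : ∀ μ : Fin d, 0 ≤ g x := fun μ => le_trans (abs_nonneg _) (hg x μ).1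
    have hh0 : ∀ μ : Fin d, 0 ≤ h x := fun μ => le_trans (abs_nonneg _) (hh x μ)
    have hT0 : ∀ μ, 0 ≤ T μ := fun μ => by
      have := hg0 μ; have := hh0 μ; positivity
    have hS0 : 0 ≤ ∑ μ, T μ := sum_nonneg fun μ _ => hT0 μ
    have h2 : ‖(LapS N c *ᵥ fun y => (φ y : ℂ) * z y) x‖ ^ 2 ≤ 2 * A ^ 2 + 2 * (∑ μ, T μ) ^ 2 := by
      have := pow_le_pow_left₀ (norm_nonneg _) h1 2
      nlinarith [sq_nonneg (A - ∑ μ, T μ)]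
    have h3 : (∑ μ, T μ) ^ 2 ≤ d * ∑ μ, T μ ^ 2 := by
      have := sq_sum_le_card_mul_sum_sq (s := (univ : Finset (Fin d))) (f := T)
      rwa [card_univ, Fintype.card_fin] at this
    have h4 : ∀ μ, T μ ^ 2 ≤ 3 * (‖c‖ ^ 2 * g x ^ 2 * ‖(sdiff N c μ *ᵥ z) x‖ ^ 2
        + ‖c‖ ^ 2 * g x ^ 2 * ‖(sdiff N c μ *ᵥ z) (x - unitVec N μ)‖ ^ 2 + (‖c‖ ^ 2) ^ 2 * h x ^ 2 * ‖z x‖ ^ 2) := fun μ => by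
      have e : T μ = ‖c‖ * g x * ‖(sdiff N c μ *ᵥ z) x‖ + ‖c‖ * g x * ‖(sdiff N c μ *ᵥ z) (x - unitVec N μ)‖
          + ‖c‖ ^ 2 * h x * ‖z x‖ := by rw [hT]; ring
      rw [e]
      set p := ‖c‖ * g x * ‖(sdiff N c μ *ᵥ z) x‖
      set q := ‖c‖ * g x * ‖(sdiff N c μ *ᵥ z) (x - unitVec N μ)‖
      set r := ‖c‖ ^ 2 * h x * ‖z x‖
      have h3' : (p + q + r) ^ 2 ≤ 3 * (p ^ 2 + q ^ 2 + r ^ 2) := by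
        nlinarith [sq_nonneg (p - q), sq_nonneg (p - r), sq_nonneg (q - r)]
      refine h3'.trans (le_of_eq ?_)
      simp only [p, q, r]
      ring
    have hA2 : A ^ 2 ≤ φ x ^ 2 * ‖(LapS N c *ᵥ z) x‖ ^ 2 := by rw [hA, mul_pow, sq_abs]
    have h5 : (∑ μ, T μ) ^ 2 ≤ d * ∑ μ, 3 * (‖c‖ ^ 2 * g x ^ 2 * ‖(sdiff N c μ *ᵥ z) x‖ ^ 2
        + ‖c‖ ^ 2 * g x ^ 2 * ‖(sdiff N c μ *ᵥ z) (x - unitVec N μ)‖ ^ 2 + (‖c‖ ^ 2) ^ 2 * h x ^ 2 * ‖z x‖ ^ 2) :=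
      h3.trans (mul_le_mul_of_nonneg_left (sum_le_sum fun μ _ => h4 μ) (Nat.cast_nonneg d))
    nlinarith
  -- regroup the pointwise bound and sum over `x ∈ Ω`
  have hpt' : ∀ x, ‖(LapS N c *ᵥ fun y => (φ y : ℂ) * z y) x‖ ^ 2
      ≤ 2 * (φ x ^ 2 * ‖(LapS N c *ᵥ z) x‖ ^ 2)
        + (6 * d * ‖c‖ ^ 2) * ∑ μ, (g x ^ 2 * ‖(sdiff N c μ *ᵥ z) x‖ ^ 2 + g x ^ 2 * ‖(sdiff N c μ *ᵥ z) (x - unitVec N μ)‖ ^ 2)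
        + (6 * (d : ℝ) ^ 2 * (‖c‖ ^ 2) ^ 2) * (h x ^ 2 * ‖z x‖ ^ 2) := by
    intro x
    refine (hpt x).trans (le_of_eq ?_)
    simp only [mul_add, sum_add_distrib, ← mul_sum, sum_const, card_univ, Fintype.card_fin, nsmul_eq_mul]
    ring
  have hsum := sum_le_sum fun x (_ : x ∈ Ω) => hpt' x
  refine hsum.trans ?_
  rw [sum_add_distrib, sum_add_distrib, ← mul_sum, ← mul_sum, ← mul_sum, sum_comm]
  have hE := sum_le_sum fun μ (_ : μ ∈ (univ : Finset (Fin d))) => sum_local_energy_le c Ω z (g := g) μ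
  have hc0 : 0 ≤ 6 * (d : ℝ) * ‖c‖ ^ 2 := by positivity
  have := mul_le_mul_of_nonneg_left hE hc0
  linarith

/-- **THE END — THE CUTOFF `H²` INEQUALITY WITH LOCAL REMAINDERS** (`z` supported in `Ω`; `φ` a real cutoff with position-dependent
difference bounds `g`, `h`, vanishing on the `Ω`-neighbours of every corner site of `Ω`):
`Σ_μ Σ_{x∈Ω} φ(x)²|(P_μz)(x)|² ≤ 8Σ_{x∈Ω}φ²|Δz|² + (24d + 4)‖c‖²·Σ_μ Σ_x (g(x)² + g(x+e_μ)²)|(∂_μz)(x)|² + (24d² + 4d)(‖c‖²)²·Σ_{x∈Ω} h(x)²|z(x)|²`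
— no shape hypothesis on `Ω`; the remainders live on the transition layer of `φ`. [folklore] -/
theorem weighted_hdiag_le_local (hz : SuppIn N Ω z)
    (hg : ∀ y ν, |φ (y + unitVec N ν) - φ y| ≤ g y ∧ |φ (y - unitVec N ν) - φ y| ≤ g y)
    (hh : ∀ y ν, |φ (y + unitVec N ν) + φ (y - unitVec N ν) - 2 * φ y| ≤ h y)
    (hcorner : ∀ x ∈ cornerSites Ω, ∀ μ, (x + unitVec N μ ∈ Ω → φ (x + unitVec N μ) = 0) ∧ (x - unitVec N μ ∈ Ω → φ (x - unitVec N μ) = 0)) :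
    ∑ μ, ∑ x ∈ Ω, φ x ^ 2 * ‖(Pdir N c μ *ᵥ z) x‖ ^ 2
      ≤ 8 * ∑ x ∈ Ω, φ x ^ 2 * ‖(LapS N c *ᵥ z) x‖ ^ 2
        + (24 * d + 4) * ‖c‖ ^ 2 * ∑ μ, ∑ x, (g x ^ 2 + g (x + unitVec N μ) ^ 2) * ‖(sdiff N c μ *ᵥ z) x‖ ^ 2
        + (24 * (d : ℝ) ^ 2 + 4 * d) * (‖c‖ ^ 2) ^ 2 * ∑ x ∈ Ω, h x ^ 2 * ‖z x‖ ^ 2 := by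
  set w : Tor N → ℂ := fun y => (φ y : ℂ) * z y with hw
  have hws : SuppIn N Ω w := fun x hx => by simp only [hw, hz x hx, mul_zero]
  have hwv : ∀ x ∈ cornerSites Ω, ∀ μ, w (x + unitVec N μ) = 0 ∧ w (x - unitVec N μ) = 0 := by
    intro x hx μ
    refine ⟨?_, ?_⟩
    · by_cases hm : x + unitVec N μ ∈ Ω
      · simp only [hw, (hcorner x hx μ).1 hm, Complex.ofReal_zero, zero_mul]
      · simp only [hw, hz _ hm, mul_zero]
    · by_cases hm : x - unitVec N μ ∈ Ω
      · simp only [hw, (hcorner x hx μ).2 hm, Complex.ofReal_zero, zero_mul]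
      · simp only [hw, hz _ hm, mul_zero]
  -- step 1: pointwise squares summed
  have h1 : ∑ μ, ∑ x ∈ Ω, φ x ^ 2 * ‖(Pdir N c μ *ᵥ z) x‖ ^ 2
      ≤ 4 * Hdiag c Ω w + 4 * ‖c‖ ^ 2 * ∑ μ, ∑ x, (g x ^ 2 + g (x + unitVec N μ) ^ 2) * ‖(sdiff N c μ *ᵥ z) x‖ ^ 2
        + 4 * d * (‖c‖ ^ 2) ^ 2 * ∑ x ∈ Ω, h x ^ 2 * ‖z x‖ ^ 2 := by
    have hpt : ∀ μ x, φ x ^ 2 * ‖(Pdir N c μ *ᵥ z) x‖ ^ 2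
        ≤ 4 * ‖(Pdir N c μ *ᵥ w) x‖ ^ 2
          + (4 * ‖c‖ ^ 2) * (g x ^ 2 * ‖(sdiff N c μ *ᵥ z) x‖ ^ 2 + g x ^ 2 * ‖(sdiff N c μ *ᵥ z) (x - unitVec N μ)‖ ^ 2)
          + (4 * (‖c‖ ^ 2) ^ 2) * (h x ^ 2 * ‖z x‖ ^ 2) := fun μ x =>
      (sq_phi_mul_normSq_Pdir_le_local c μ hg hh z x).trans (le_of_eq (by ring))
    have hsum : ∑ μ, ∑ x ∈ Ω, φ x ^ 2 * ‖(Pdir N c μ *ᵥ z) x‖ ^ 2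
        ≤ ∑ μ, ∑ x ∈ Ω, (4 * ‖(Pdir N c μ *ᵥ w) x‖ ^ 2
          + (4 * ‖c‖ ^ 2) * (g x ^ 2 * ‖(sdiff N c μ *ᵥ z) x‖ ^ 2 + g x ^ 2 * ‖(sdiff N c μ *ᵥ z) (x - unitVec N μ)‖ ^ 2)
          + (4 * (‖c‖ ^ 2) ^ 2) * (h x ^ 2 * ‖z x‖ ^ 2)) :=
      sum_le_sum fun μ _ => sum_le_sum fun x _ => hpt μ x
    refine hsum.trans ?_
    simp only [sum_add_distrib, ← mul_sum, sum_const, card_univ, Fintype.card_fin, nsmul_eq_mul]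
    unfold Hdiag
    have hE := sum_le_sum fun μ (_ : μ ∈ (univ : Finset (Fin d))) => sum_local_energy_le c Ω z (g := g) μ
    simp only [sum_add_distrib] at hE
    have hc0 : 0 ≤ 4 * ‖c‖ ^ 2 := by positivity
    have := mul_le_mul_of_nonneg_left hE hc0
    linarith
  -- step 2: `Hdiag(w) ≤ Σ_Ω |Δw|²` (file 1, corner-vanish form)
  have h2 : Hdiag c Ω w ≤ ∑ x ∈ Ω, ‖(LapS N c *ᵥ w) x‖ ^ 2 :=
    le_trans (le_add_of_nonneg_right (hmixed_nonneg c w)) (hdiag_le_of_cornerVanish hws hwv c)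
  -- step 3: the `Δ` side
  have h3 := sum_normSq_LapS_phi_mul_le_local c Ω z hg hh
  nlinarith [h1, h2, h3]

end Sums

end Summit.QuantumFields.BalabanUV.T4Continuum.DirichletCornerCutoffH2Local

end
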